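import Summits.BirchSwinnertonDyer.BirchSwinnertonDyer.Theorems.SignedLowerHalvesSmallImageLowerHalfBothSignsRttD2SeqJ3TorsionLevels
import Literature.NumberTheory.GaloisCohomology.LocalPairingSubgroup
import Literature.NumberTheory.GaloisRepresentations.EulerSystem
import Literature.NumberTheory.GaloisRepresentations.ConjugationDescent
import Literature.NumberTheory.GaloisRepresentations.BrauerTowerBound
import Literature.AnabelianGeometry.AbsoluteAnabelian.LocalResidueMapQmodZ
import HarnessLib

/-!
# Route `SignedLowerHalves`, crux L `SmallImageLowerHalfBothSigns` (stmt-BirchSwinnertonDyer-23599), line `rtt_w3` v14 → v15 — E2, row J3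
# (Galois side, part β₃a): THE LOCAL TATE PAIRINGS OF THE LAYERS `K_{n,v}` WITH TORSION COEFFICIENTS `M[p^k]` — `⟨a, ℓ⟩_{n,k} = inv_{U_n}(a ∪ ℓ)/p^k ∈ ℚ/ℤ` —
# and three of their four socket laws: Galois invariance (⟹ `conj_{g⁻¹} ⊣ conj_g`), the projection formula (`cores ⊣ res`), the coefficient balance

WIDTH seat `bsd-line-slh-p3-w3` g22 under LEAD `cruxlead-stmt-BirchSwinnertonDyer-23599` g11 (cell `bsd-ssimc`); helper `--supports stmt-BirchSwinnertonDyer-23599`.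
DEFINITIONS WITH BODIES + THEOREMS; no named fact, no instance, no `sorry` (closedness / finite index of the `U_n` and, for cup-product naturality, compactness of `Γ_{K_v}` enter as
INSTANCE BINDERS, supplied by `Subgroup.isClosed_of_isOpen`, `Fintype.ofFinite`, `absoluteGaloisGroup_compactSpace`). HONEST FRAMING: this is the LOCAL half of an inhabitant of
the finite-level socket `LayerPairing` (p784142): the tree's local pairing `localPairingSubgroup` (cup product + `inv_{U_n} = inv_v ∘ cor`, `GaloisCohomology/LocalPairingSubgroup`)
on the open subgroups `U_n = Gal(K̄_v/K_n·K_v)` of `Γ_{K_v}`, read in `ℚ/ℤ`, against the torsion levels `M[p^k]` of part β₂ (p785597). The GLOBAL half (`loc_v` on honda's layer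
groups, Mackey) and the level law `red ⊣ incl` are the sequel; E2, crux L, crux M and BSD remain OPEN and are proved for NO curve.

* §1 `repOfAction`, `torsRep M hstab p k : ContinuousRep Γ ℤ M[p^k]` — the torsion level in the tree's `ContinuousRep` dialect; its restricted `TopRep` IS the tree's
  `discreteTopRep S M[p^k]` (`rfl`): `H¹` of it IS `subgroupH1 S M[p^k]`, `resLe`/`conjMap` ARE `resOfLe`/`conjH1` (`resLe_torsRep_eq_resOfLe`, `conjMap_torsRep_eq_conjH1`) — the
  two cohomology dialects of the tree agree definitionally; statements below stay in the `ContinuousRep` dialect and consumers convert with these `rfl` lemmas.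
* §2 ★ `pairLoc n k : H¹(U_n, X_k) →+ Hom(H¹(U_n, M[p^k]), ℚ/ℤ)` for a family of local coefficient representations `X_k` (meant `(𝒪 ⊗ μ_{p^k} ⊗ θ′)|_{Γ_{K_v}}`) with pairings
  `P_k : X_k × M[p^k] → μ_{p^k}`: `(a, ℓ) ↦ inv_{U_n}(a ∪ ℓ)/p^k`.
* §3 LAWS: ★ `pairLoc_conjMap` (invariance `⟨g·a, g·ℓ⟩ = ⟨a, ℓ⟩`) and `pairLoc_conjMap_inv` (`⟨g⁻¹·a, ℓ⟩ = ⟨a, g·ℓ⟩` — the shape of `LayerPairing.pairNK_conj` after (F2));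
  ★ `pairLoc_coresLe` (`⟨cor a′, ℓ⟩_n = ⟨a′, res ℓ⟩_{n+1}`, the tree's projection formula); ★ `pairLoc_coeffMapH1` (`⟨H¹(c)a, ℓ⟩ = ⟨a, H¹(r·)ℓ⟩` whenever `P(c x, m) = P(x, r m)` —
  `cupProduct_mapPair` twice through the twisted pairing `P ∘ (c × id)`).
References: [NeukirchSchmidtWingberg2008] I §5 Prop. 1.5.3 (iii)(iv), (7.2.6); [SerreLocalFields1979] XI §2 Prop. 1, XIII §3; [Rubin2000] §4.2, App. B.2; [Kato2004Asterisque] §17.13.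
-/

set_option autoImplicit false
set_option linter.dupNamespace false -- D-0017: single-problem summit, the namespace repeats the problem name by design
noncomputable section

open scoped Classical
open NumberField IsDedekindDomain Field CategoryTheory

namespace Summit.BirchSwinnertonDyer.BirchSwinnertonDyer.Theorems.SmallImageRttD2Seq

open Literature.NumberTheory.EllipticCurves Literature.NumberTheory.GaloisRepresentations Literature.NumberTheory.GaloisCohomology
open Literature.AnabelianGeometry.AbsoluteAnabelian.Prop121vii (zmodToQmodZ)

/-! ## §1. Torsion levels as continuous representations; the two cohomology dialects agree -/

section TorsRep

variable {G : Type} [Group G] [TopologicalSpace G] [IsTopologicalGroup G]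
  (N : Type) [AddCommGroup N] [DistribMulAction G N] [TopologicalSpace N] [DiscreteTopology N]

/-- A discrete `G`-module with open stabilisers as a continuous representation (tree `ContinuousRep`), with `toRepresentation g = (g • ·)`. [cite: SerreGaloisCohomology1997, I §2.1] -/
def repOfAction (hstab : ∀ m : N, IsOpen (MulAction.stabilizer G m : Set G)) : ContinuousRep G ℤ N :=
  ContinuousRep.ofStabilizerMemNhdsOne
    { toFun := fun g ↦ (DistribSMul.toAddMonoidHom N g).toIntLinearMap
      map_one' := by ext m; simp
      map_mul' := fun g h ↦ by ext m; simp [mul_smul] }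
    (fun m ↦ (hstab m).mem_nhds (by simp))

/-- **The two dialects agree**: `repOfAction` restricted to a subgroup `S`, as a `TopRep`, IS the tree's `discreteTopRep S N` (definitional). [folklore] -/
theorem toTopRep_restrict_repOfAction (hstab : ∀ m : N, IsOpen (MulAction.stabilizer G m : Set G)) (S : Subgroup G) :
    ((repOfAction N hstab).restrict (Literature.NumberTheory.GaloisRepresentations.subgroupIncl S)).toTopRep = discreteTopRep S N :=
  rfl

/-- The identity of `ρ.toTopRep` as a morphism out of its restriction along `id` (the shape `ContinuousCohomology.map` consumes). [folklore] -/
def idResHom (ρ : ContinuousRep G ℤ N) : TopRep.res ((ContinuousMonoidHom.id G : G →ₜ* G) : G →* G) ρ.toTopRep ⟶ ρ.toTopRep :=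
  TopRep.ofHom ⟨ContinuousLinearMap.id ℤ N, fun _ ↦ rfl⟩

omit [IsTopologicalGroup G] [DistribMulAction G N] in
/-- Unfolding `idResHom`. [folklore] -/
theorem idResHom_hom_apply (ρ : ContinuousRep G ℤ N) (x : N) : (idResHom N ρ).hom x = x :=
  rfl

omit [IsTopologicalGroup G] [TopologicalSpace N] [DiscreteTopology N] in
variable {N} in
/-- Open stabilisers pass to the torsion levels. [folklore] -/
theorem isOpen_stabilizer_torsionPow (hstab : ∀ m : N, IsOpen (MulAction.stabilizer G m : Set G)) (p k : ℕ) (m : ↥(torsionPow N p k)) :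
    IsOpen (MulAction.stabilizer G m : Set G) := by
  have h : (MulAction.stabilizer G m : Set G) = (MulAction.stabilizer G (m : N) : Set G) := by
    ext g
    simp only [SetLike.mem_coe, MulAction.mem_stabilizer_iff]
    exact ⟨fun h ↦ congrArg Subtype.val h, fun h ↦ Subtype.ext h⟩
  rw [h]; exact hstab m

/-- **`M[p^k]` as a continuous representation of `G`.** [cite: Rubin2000, §4.2] -/
def torsRep (hstab : ∀ m : N, IsOpen (MulAction.stabilizer G m : Set G)) (p k : ℕ) : ContinuousRep G ℤ ↥(torsionPow N p k) :=
  repOfAction (↥(torsionPow N p k)) (isOpen_stabilizer_torsionPow hstab p k)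

/-- The restricted `torsRep` as a `TopRep` IS `discreteTopRep S M[p^k]` (definitional) — so `H¹` of it IS `subgroupH1 S M[p^k]`. [folklore] -/
theorem toTopRep_restrict_torsRep (hstab : ∀ m : N, IsOpen (MulAction.stabilizer G m : Set G)) (p k : ℕ) (S : Subgroup G) :
    ((torsRep N hstab p k).restrict (Literature.NumberTheory.GaloisRepresentations.subgroupIncl S)).toTopRep = discreteTopRep S ↥(torsionPow N p k) :=
  rfl

/-- The conjugation `conjMap` on `H¹(S, M[p^k])` in the `ContinuousRep` dialect IS the tree's `conjH1` (definitional). [folklore] -/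
theorem conjMap_torsRep_eq_conjH1 (hstab : ∀ m : N, IsOpen (MulAction.stabilizer G m : Set G)) (p k : ℕ) (S : Subgroup G) [S.Normal] (g : G)
    (ℓ : subgroupH1 S ↥(torsionPow N p k)) :
    conjMap (torsRep N hstab p k).toTopRep S g 1 ℓ = conjH1 S ↥(torsionPow N p k) g ℓ :=
  rfl

/-- The restriction `resLe` on `H¹(·, M[p^k])` in the `ContinuousRep` dialect IS the tree's `resOfLe` (definitional). [folklore] -/
theorem resLe_torsRep_eq_resOfLe (hstab : ∀ m : N, IsOpen (MulAction.stabilizer G m : Set G)) (p k : ℕ) {S S' : Subgroup G} (h : S' ≤ S)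
    (ℓ : subgroupH1 S ↥(torsionPow N p k)) :
    resLe (torsRep N hstab p k).toTopRep h 1 ℓ = resOfLe ↥(torsionPow N p k) h ℓ :=
  rfl

/-- The scalar `r` on `H¹(S, M[p^k])` in the `ContinuousRep` dialect (Mathlib's map along `(id, r·)`) IS the tree-side `torsScalar` (definitional).
[cite: Rubin2000, §4.2] -/
theorem map_resHomOfEquivariant_eq_torsScalar (p k : ℕ) (S : Subgroup G)
    {R : Type*} [Monoid R] [DistribMulAction R N] [SMulCommClass G R N] (r : R) (ℓ : subgroupH1 S ↥(torsionPow N p k)) :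
    ContinuousCohomology.map (ContinuousMonoidHom.id S)
        (resHomOfEquivariant (ContinuousMonoidHom.id S) (DistribSMul.toAddMonoidHom (↥(torsionPow N p k)) r) fun x m ↦ Subtype.ext <| by
          change r • ((x : G) • (m : N)) = (x : G) • (r • (m : N))
          exact (smul_comm (x : G) r (m : N)).symm) 1 ℓ =
      torsScalar N p S k r ℓ :=
  rfl

end TorsRep

/-! ## §2. The local pairings `⟨a, ℓ⟩_{n,k} = inv_{U_n}(a ∪ ℓ)/p^k` -/

section Local

variable {K : Type} [Field K] [NumberField K] {p : ℕ} [Fact p.Prime] (κ : ZpExtension K p) (v : HeightOneSpectrum (𝓞 K))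
  (M : Type) [AddCommGroup M] [DistribMulAction (absoluteGaloisGroup (v.adicCompletion K)) M] [TopologicalSpace M] [DiscreteTopology M]
  (hstab : ∀ m : M, IsOpen (MulAction.stabilizer (absoluteGaloisGroup (v.adicCompletion K)) m : Set (absoluteGaloisGroup (v.adicCompletion K))))
  {MX : ℕ → Type} [∀ k, AddCommGroup (MX k)] [∀ k, TopologicalSpace (MX k)] [∀ k, DiscreteTopology (MX k)]
  (ρX : ∀ k : ℕ, ContinuousRep (absoluteGaloisGroup (v.adicCompletion K)) ℤ (MX k))
  (P : ∀ k : ℕ, ContPairing (ρX k).toTopRep (torsRep M hstab p k).toTopRep (muAt K (p ^ k) v).toTopRep)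

/-- The pairing twisted by an equivariant coefficient endomorphism `c` of `X_k` on the left: `(x, m) ↦ P_k(c x, m)`. [cite: NeukirchSchmidtWingberg2008, I §5 Prop. 1.5.3] -/
def twistPairing (k : ℕ) (c : MX k →+ MX k) (hc : ∀ (g : absoluteGaloisGroup (v.adicCompletion K)) (x : MX k), c (ρX k g x) = ρX k g (c x)) :
    ContPairing (ρX k).toTopRep (torsRep M hstab p k).toTopRep (muAt K (p ^ k) v).toTopRep where
  toLin := (P k).toLin.comp c.toIntLinearMap
  continuous_toLin := continuous_of_discreteTopology
  toLin_smul g x y := by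
    change (P k).toLin (c (ρX k g x)) ((torsRep M hstab p k).toTopRep.ρ g y) = _
    rw [hc]
    exact (P k).toLin_smul g (c x) y

/-- The coefficient morphism `(id, c)` on the restriction of `X_k` to a subgroup `S` (the shape `ContinuousCohomology.map` consumes). [cite: NeukirchSchmidtWingberg2008, I §5] -/
def coeffResHom (S : Subgroup (absoluteGaloisGroup (v.adicCompletion K))) (k : ℕ) (c : MX k →+ MX k)
    (hc : ∀ (g : absoluteGaloisGroup (v.adicCompletion K)) (x : MX k), c (ρX k g x) = ρX k g (c x)) :
    TopRep.res ((ContinuousMonoidHom.id ↥S : ↥S →ₜ* ↥S) : ↥S →* ↥S) ((ρX k).restrict (Literature.NumberTheory.GaloisRepresentations.subgroupIncl S)).toTopRep ⟶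
      ((ρX k).restrict (Literature.NumberTheory.GaloisRepresentations.subgroupIncl S)).toTopRep :=
  TopRep.ofHom ⟨⟨c.toIntLinearMap, continuous_of_discreteTopology⟩, fun g ↦ ContinuousLinearMap.ext fun x ↦ by
    change c (ρX k (g : absoluteGaloisGroup (v.adicCompletion K)) x) = ρX k (g : absoluteGaloisGroup (v.adicCompletion K)) (c x)
    exact hc _ x⟩

/-- The coefficient endomorphism `H¹(c)` of `H¹(S, X_k)`: Mathlib's `ContinuousCohomology.map` along `(id, c)`. [cite: NeukirchSchmidtWingberg2008, I §5] -/
def coeffMapH1 (S : Subgroup (absoluteGaloisGroup (v.adicCompletion K))) (k : ℕ) (c : MX k →+ MX k)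
    (hc : ∀ (g : absoluteGaloisGroup (v.adicCompletion K)) (x : MX k), c (ρX k g x) = ρX k g (c x)) :
    (continuousCohomology 1 ((ρX k).restrict (Literature.NumberTheory.GaloisRepresentations.subgroupIncl S)).toTopRep : Type) →+
      (continuousCohomology 1 ((ρX k).restrict (Literature.NumberTheory.GaloisRepresentations.subgroupIncl S)).toTopRep : Type) :=
  (ContinuousCohomology.map (ContinuousMonoidHom.id ↥S) (coeffResHom v ρX S k c hc) 1).hom.toLinearMap.toAddMonoidHom

/-- Unfolding `coeffMapH1`. [folklore] -/
theorem coeffMapH1_apply (S : Subgroup (absoluteGaloisGroup (v.adicCompletion K))) (k : ℕ) (c : MX k →+ MX k)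
    (hc : ∀ (g : absoluteGaloisGroup (v.adicCompletion K)) (x : MX k), c (ρX k g x) = ρX k g (c x))
    (a : continuousCohomology 1 ((ρX k).restrict (Literature.NumberTheory.GaloisRepresentations.subgroupIncl S)).toTopRep) :
    coeffMapH1 v ρX S k c hc a = ContinuousCohomology.map (ContinuousMonoidHom.id ↥S) (coeffResHom v ρX S k c hc) 1 a :=
  rfl

variable [hcl : ∀ n : ℕ, IsClosed (localSubgroupOfEmb (κ.layerSubgroup n) (closureEmb (K := K) (v.adicCompletion K)) : Set (absoluteGaloisGroup (v.adicCompletion K)))]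
  [hq : ∀ n : ℕ, Fintype (absoluteGaloisGroup (v.adicCompletion K) ⧸ localSubgroupOfEmb (κ.layerSubgroup n) (closureEmb (K := K) (v.adicCompletion K)))]

/-- ★ **The local Tate pairing of the layer `K_{n,v}` with `p^k`-torsion coefficients, read in `ℚ/ℤ`**: for `a ∈ H¹(U_n, X_k)` and `ℓ ∈ H¹(U_n, M[p^k])`,
`⟨a, ℓ⟩_{n,k} := inv_{U_n}(a ∪_{P_k} ℓ)/p^k` (the tree's `localPairingSubgroup` on the open subgroup `U_n ≤ Γ_{K_v}`, then `ℤ/p^k ↪ ℚ/ℤ`).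
[cite: NeukirchSchmidtWingberg2008, I §5 Prop. 1.5.3 (iv), (7.2.6)] [cite: SerreLocalFields1979, XI §2 Prop. 1] -/
def pairLoc (n k : ℕ) :
    (continuousCohomology 1 ((ρX k).restrict (Literature.NumberTheory.GaloisRepresentations.subgroupIncl
        (localSubgroupOfEmb (κ.layerSubgroup n) (closureEmb (K := K) (v.adicCompletion K))))).toTopRep : Type) →+
      ((continuousCohomology 1 ((torsRep M hstab p k).restrict (Literature.NumberTheory.GaloisRepresentations.subgroupIncl
        (localSubgroupOfEmb (κ.layerSubgroup n) (closureEmb (K := K) (v.adicCompletion K))))).toTopRep : Type) →+ AddCircle (1 : ℚ)) :=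
  haveI : NeZero (p ^ k) := ⟨pow_ne_zero _ (Fact.out : p.Prime).ne_zero⟩
  (AddMonoidHom.compHom (zmodToQmodZ (p ^ k))).comp
    (localPairingSubgroup K (p ^ k) v (ρX k) (torsRep M hstab p k) (P k) (localSubgroupOfEmb (κ.layerSubgroup n) (closureEmb (K := K) (v.adicCompletion K))))

/-- Unfolding `pairLoc`. [cite: NeukirchSchmidtWingberg2008, I §5 Prop. 1.5.3 (iv)] -/
theorem pairLoc_apply (n k : ℕ)
    (a : continuousCohomology 1 ((ρX k).restrict (Literature.NumberTheory.GaloisRepresentations.subgroupIncl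
        (localSubgroupOfEmb (κ.layerSubgroup n) (closureEmb (K := K) (v.adicCompletion K))))).toTopRep)
    (ℓ : continuousCohomology 1 ((torsRep M hstab p k).restrict (Literature.NumberTheory.GaloisRepresentations.subgroupIncl
        (localSubgroupOfEmb (κ.layerSubgroup n) (closureEmb (K := K) (v.adicCompletion K))))).toTopRep) :
    pairLoc κ v M hstab ρX P n k a ℓ =
      haveI : NeZero (p ^ k) := ⟨pow_ne_zero _ (Fact.out : p.Prime).ne_zero⟩
      zmodToQmodZ (p ^ k) (localPairingSubgroup K (p ^ k) v (ρX k) (torsRep M hstab p k) (P k)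
        (localSubgroupOfEmb (κ.layerSubgroup n) (closureEmb (K := K) (v.adicCompletion K))) a ℓ) :=
  rfl

/-! ## §3. The laws -/

/-- ★ **Galois invariance `⟨g·a, g·ℓ⟩_{n,k} = ⟨a, ℓ⟩_{n,k}`** (`g ∈ Γ_{K_v}`; the tree's `localPairingSubgroup_conjMap`). [cite: NeukirchSchmidtWingberg2008, I §5 Prop. 1.5.3 (iii)] -/
theorem pairLoc_conjMap (n k : ℕ) (g : absoluteGaloisGroup (v.adicCompletion K))
    (a : continuousCohomology 1 ((ρX k).restrict (Literature.NumberTheory.GaloisRepresentations.subgroupIncl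
        (localSubgroupOfEmb (κ.layerSubgroup n) (closureEmb (K := K) (v.adicCompletion K))))).toTopRep)
    (ℓ : continuousCohomology 1 ((torsRep M hstab p k).restrict (Literature.NumberTheory.GaloisRepresentations.subgroupIncl
        (localSubgroupOfEmb (κ.layerSubgroup n) (closureEmb (K := K) (v.adicCompletion K))))).toTopRep) :
    haveI := normal_localSubgroupOfEmb_layerSubgroup κ v n
    pairLoc κ v M hstab ρX P n k (conjMap (ρX k).toTopRep _ g 1 a) (conjMap (torsRep M hstab p k).toTopRep _ g 1 ℓ) = pairLoc κ v M hstab ρX P n k a ℓ := by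
  haveI := normal_localSubgroupOfEmb_layerSubgroup κ v n
  haveI : NeZero (p ^ k) := ⟨pow_ne_zero _ (Fact.out : p.Prime).ne_zero⟩
  rw [pairLoc_apply, pairLoc_apply, localPairingSubgroup_conjMap]

/-- ★ **`⟨g⁻¹·a, ℓ⟩_{n,k} = ⟨a, g·ℓ⟩_{n,k}`** — the adjointness WITH INVERSE behind `LayerPairing.pairNK_conj` (RULING (F2)). [cite: NeukirchSchmidtWingberg2008, I §5 Prop. 1.5.3 (iii)]
[cite: Kato2004Asterisque, §17.13] -/
theorem pairLoc_conjMap_inv (n k : ℕ) (g : absoluteGaloisGroup (v.adicCompletion K))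
    (a : continuousCohomology 1 ((ρX k).restrict (Literature.NumberTheory.GaloisRepresentations.subgroupIncl
        (localSubgroupOfEmb (κ.layerSubgroup n) (closureEmb (K := K) (v.adicCompletion K))))).toTopRep)
    (ℓ : continuousCohomology 1 ((torsRep M hstab p k).restrict (Literature.NumberTheory.GaloisRepresentations.subgroupIncl
        (localSubgroupOfEmb (κ.layerSubgroup n) (closureEmb (K := K) (v.adicCompletion K))))).toTopRep) :
    haveI := normal_localSubgroupOfEmb_layerSubgroup κ v n
    pairLoc κ v M hstab ρX P n k (conjMap (ρX k).toTopRep _ g⁻¹ 1 a) ℓ = pairLoc κ v M hstab ρX P n k a (conjMap (torsRep M hstab p k).toTopRep _ g 1 ℓ) := by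
  haveI := normal_localSubgroupOfEmb_layerSubgroup κ v n
  rw [← pairLoc_conjMap κ v M hstab ρX P n k g (conjMap (ρX k).toTopRep _ g⁻¹ 1 a), ← conjMap_mul_apply_one, mul_inv_cancel, conjMap_one_one]

section Cores

variable [hqq : ∀ n : ℕ, Fintype (↥(localSubgroupOfEmb (κ.layerSubgroup n) (closureEmb (K := K) (v.adicCompletion K))) ⧸
  (localSubgroupOfEmb (κ.layerSubgroup (n + 1)) (closureEmb (K := K) (v.adicCompletion K))).subgroupOf
    (localSubgroupOfEmb (κ.layerSubgroup n) (closureEmb (K := K) (v.adicCompletion K))))]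

/-- ★ **The projection formula `⟨cor_{n+1→n} a′, ℓ⟩_{n,k} = ⟨a′, res_{n→n+1} ℓ⟩_{n+1,k}`** (the tree's `localPairingSubgroup_coresLe`).
[cite: NeukirchSchmidtWingberg2008, I §5 Prop. 1.5.3 (iv), (7.2.6)] -/
theorem pairLoc_coresLe (n k : ℕ)
    (a' : continuousCohomology 1 ((ρX k).restrict (Literature.NumberTheory.GaloisRepresentations.subgroupIncl
        (localSubgroupOfEmb (κ.layerSubgroup (n + 1)) (closureEmb (K := K) (v.adicCompletion K))))).toTopRep)
    (ℓ : continuousCohomology 1 ((torsRep M hstab p k).restrict (Literature.NumberTheory.GaloisRepresentations.subgroupIncl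
        (localSubgroupOfEmb (κ.layerSubgroup n) (closureEmb (K := K) (v.adicCompletion K))))).toTopRep) :
    pairLoc κ v M hstab ρX P n k (coresLe (ρX k).toTopRep (localSubgroupOfEmb_layerSubgroup_antitone κ v (Nat.le_succ n))
        (isOpen_localSubgroupOfEmb_layerSubgroup κ v (n + 1)) a') ℓ =
      pairLoc κ v M hstab ρX P (n + 1) k a' (resLe (torsRep M hstab p k).toTopRep (localSubgroupOfEmb_layerSubgroup_antitone κ v (Nat.le_succ n)) 1 ℓ) := by
  haveI : NeZero (p ^ k) := ⟨pow_ne_zero _ (Fact.out : p.Prime).ne_zero⟩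
  rw [pairLoc_apply, pairLoc_apply, localPairingSubgroup_coresLe]

end Cores

section Scalar

variable {R : Type*} [Monoid R] [DistribMulAction R M] [SMulCommClass (absoluteGaloisGroup (v.adicCompletion K)) R M]

/-- ★ **The coefficient balance `⟨H¹(c) a, ℓ⟩_{n,k} = ⟨a, H¹(r·) ℓ⟩_{n,k}`** whenever `P_k(c x, m) = P_k(x, r·m)` (e.g. `c = (r·) ⊗ id` on `𝒪 ⊗ μ ⊗ θ′` against the `𝒪`-action on `M[p^k]`):
naturality of the cup product along `(c, id)` and along `(id, r·)` to the same twisted pairing; `H¹(r·)` IS `torsScalar` (`map_resHomOfEquivariant_eq_torsScalar`).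
[cite: NeukirchSchmidtWingberg2008, I §5 Prop. 1.5.3] [cite: Kato2004Asterisque, §17.13] -/
theorem pairLoc_coeffMapH1 [CompactSpace (absoluteGaloisGroup (v.adicCompletion K))] (n k : ℕ) (c : MX k →+ MX k)
    (hc : ∀ (g : absoluteGaloisGroup (v.adicCompletion K)) (x : MX k), c (ρX k g x) = ρX k g (c x))
    (r : R) (hP : ∀ (x : MX k) (m : ↥(torsionPow M p k)), (P k).toLin (c x) m = (P k).toLin x (r • m))
    (a : continuousCohomology 1 ((ρX k).restrict (Literature.NumberTheory.GaloisRepresentations.subgroupIncl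
        (localSubgroupOfEmb (κ.layerSubgroup n) (closureEmb (K := K) (v.adicCompletion K))))).toTopRep)
    (ℓ : continuousCohomology 1 ((torsRep M hstab p k).restrict (Literature.NumberTheory.GaloisRepresentations.subgroupIncl
        (localSubgroupOfEmb (κ.layerSubgroup n) (closureEmb (K := K) (v.adicCompletion K))))).toTopRep) :
    pairLoc κ v M hstab ρX P n k (coeffMapH1 v ρX _ k c hc a) ℓ =
      pairLoc κ v M hstab ρX P n k a (ContinuousCohomology.map (ContinuousMonoidHom.id _)
        (resHomOfEquivariant (ContinuousMonoidHom.id _) (DistribSMul.toAddMonoidHom (↥(torsionPow M p k)) r) fun x m ↦ Subtype.ext <| by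
          change r • ((x : absoluteGaloisGroup (v.adicCompletion K)) • (m : M)) = (x : absoluteGaloisGroup (v.adicCompletion K)) • (r • (m : M))
          exact (smul_comm (x : absoluteGaloisGroup (v.adicCompletion K)) r (m : M)).symm) 1 ℓ) := by
  haveI : NeZero (p ^ k) := ⟨pow_ne_zero _ (Fact.out : p.Prime).ne_zero⟩
  haveI : CompactSpace ↥(localSubgroupOfEmb (κ.layerSubgroup n) (closureEmb (K := K) (v.adicCompletion K))) :=
    isCompact_iff_compactSpace.mp (hcl n).isCompact
  -- both cup products are the cup product of the twisted pairing
  have h1 := ContPairing.cupProduct_mapPair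
    (resPairing (localSubgroupOfEmb (κ.layerSubgroup n) (closureEmb (K := K) (v.adicCompletion K))) (ρX k) (torsRep M hstab p k) (muAt K (p ^ k) v)
      (twistPairing v M hstab ρX P k c hc))
    (resPairing (localSubgroupOfEmb (κ.layerSubgroup n) (closureEmb (K := K) (v.adicCompletion K))) (ρX k) (torsRep M hstab p k) (muAt K (p ^ k) v) (P k))
    (ContinuousMonoidHom.id _) (coeffResHom v ρX _ k c hc) (idResHom _ _) (idResHom _ _) (fun _ _ ↦ rfl) a ℓ
  have h2 := ContPairing.cupProduct_mapPair
    (resPairing (localSubgroupOfEmb (κ.layerSubgroup n) (closureEmb (K := K) (v.adicCompletion K))) (ρX k) (torsRep M hstab p k) (muAt K (p ^ k) v)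
      (twistPairing v M hstab ρX P k c hc))
    (resPairing (localSubgroupOfEmb (κ.layerSubgroup n) (closureEmb (K := K) (v.adicCompletion K))) (ρX k) (torsRep M hstab p k) (muAt K (p ^ k) v) (P k))
    (ContinuousMonoidHom.id _) (idResHom _ _)
    (resHomOfEquivariant (ContinuousMonoidHom.id _) (DistribSMul.toAddMonoidHom (↥(torsionPow M p k)) r) fun x m ↦ Subtype.ext <| by
      change r • ((x : absoluteGaloisGroup (v.adicCompletion K)) • (m : M)) = (x : absoluteGaloisGroup (v.adicCompletion K)) • (r • (m : M))
      exact (smul_comm (x : absoluteGaloisGroup (v.adicCompletion K)) r (m : M)).symm)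
    (idResHom _ _) (fun x m ↦ hP x m) a ℓ
  rw [map_apply_of_id (ContinuousMonoidHom.id _) (fun _ ↦ rfl) (idResHom _ _) (fun _ ↦ rfl)] at h1 h2
  rw [map_apply_of_id (ContinuousMonoidHom.id _) (fun _ ↦ rfl) (idResHom _ _) (fun _ ↦ rfl)] at h1 h2
  rw [pairLoc_apply, pairLoc_apply, localPairingSubgroup_apply, localPairingSubgroup_apply, coeffMapH1_apply, ← h1, h2]
  rfl

end Scalar

end Local

end Summit.BirchSwinnertonDyer.BirchSwinnertonDyer.Theorems.SmallImageRttD2Seq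

end
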